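import Summits.CriticalPhenomena.PercolationContinuityZ3.Theorems.PercExchangeRateTransportCriticalCurveRegular
import Summits.CriticalPhenomena.PercolationContinuityZ3.Theorems.SubcritExchangeUniformity.Negative.Objects

/-!
# Witness of weakness (F3 / BC5) for the rung family `IsoTangentWithin K` — line `isotropic_tangency`
# (crux K⁺ `SupercritExchangeUniformity`, stmt-CriticalPhenomena-16061; route `PercExchangeRateTransport`)

`IsoTangentWithin Set.univ` IS the floor: it follows from the seed theorem
`Cruxes.CriticalCurveRegular.Locmod.CriticalCurveRegular_proof` (item stmt-CriticalPhenomena-16065,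
`ContinuousOn p_c (0,1) ∧ ∀ t ∈ (0,1), 0 < p_c(t) < 1` for the label-coupled anisotropic bond family on `ℤ²×ℤ`)
alone — the quotient clause "every difference quotient of `p_c` at `p₃` is within `ε` of SOME real" is
vacuous at `K = univ` (`isoTangentWithin_univ_iff`).  The rung is `K = {−1/2}` (`IsotropicTangency`:
`p_c'(p₃) = −1/2`), which the seed's proof cannot give: its Aizenman–Grimmett shear
`θ(p,t) ≤ θ(p + C(t−s), s)` holds with the constant `C = μ₀^{-N} 2^N N ≫ 1/2` (essential-enhancement
comparability of pivotal counts), so it bounds the quotients of `p_c` only inside `[−C, 0]`, never near `−1/2`;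
the sharp constant is the exchange-rate germ `a_n → 1/2` at the isotropic point, i.e. the `t ↓ p_c(ℤ³)` /
`t ↑ p_c(ℤ³)` ends of the cruxes K⁺ / K⁻.
witness_regime: anisotropic `ℤ²×ℤ` bond family at its isotropic point `t = p₃ = p_c(ℤ³) ∈ (0,1)`; nothing about
`p_c'` is known there (in print the critical curve of this family is only known to be continuous and strictly
monotone — Grimmett 1999 §3.2–3.3 argues with an ASSUMED `C¹` curve "taking some liberties", p. 59), and S
(`θ_{ℤ³}(p_c) = 0`) is not known at `d = 3` at all, so the rung lies outside S's known regime (S's analogue is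
known only for `d = 2` and `d ≥ 11`).
Self-contained copy of the family (verbatim the `def`s of `Lines/isotropic_tangency.lean`, separate namespace
`…IsoTangent.Special` so both files coexist in the build).
-/

noncomputable section

namespace Summit.CriticalPhenomena.PercolationContinuityZ3.Cruxes.SupercritExchangeUniformity.IsoTangent.Special

open Summit.CriticalPhenomena.PercolationContinuityZ3.Theses.PercExchangeRateTransport
open Summit.CriticalPhenomena.PercolationContinuityZ3.Theorems.SubcritExchangeUniformity.Negative (thetaPerc pcurve)

/-- FAMILY (graded by `K ⊆ ℝ`, monotone in `K`). The floor `CriticalCurveRegular` over the landed names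
(`pcurve = pc`, `thetaPerc = θ` of the route's `let`s, by `rfl`) AND: the difference quotients of the critical
curve at the isotropic point `p₃ = p_c(ℤ³)` eventually lie within `ε` of the set `K`, for every `ε > 0`. -/
def IsoTangentWithin (K : Set ℝ) : Prop :=
  (ContinuousOn pcurve (Set.Ioo 0 1) ∧ ∀ t ∈ Set.Ioo (0 : ℝ) 1, 0 < pcurve t ∧ pcurve t < 1) ∧
    ∀ ε > (0 : ℝ), ∃ δ > (0 : ℝ), ∀ h : ℝ, h ≠ 0 → |h| < δ →
      ∃ k ∈ K, |(pcurve (Literature.Probability.Percolation.criticalProb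
          (Literature.Probability.LatticeModels.zdGraph 3) (0 : Literature.Probability.LatticeModels.Site 3) + h) -
        pcurve (Literature.Probability.Percolation.criticalProb
          (Literature.Probability.LatticeModels.zdGraph 3) (0 : Literature.Probability.LatticeModels.Site 3))) / h - k| ≤ ε

/-- RUNG. The critical curve is differentiable at the isotropic point with slope `−1/2`:
the family at `K = {−1/2}`. -/
def IsotropicTangency : Prop := IsoTangentWithin {-(1 / 2 : ℝ)}


/-- The floor, read over the landed names: `CriticalCurveRegular` is literally the first conjunct. -/
theorem criticalCurveRegular_iff_named :
    CriticalCurveRegular ↔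
      (ContinuousOn pcurve (Set.Ioo 0 1) ∧ ∀ t ∈ Set.Ioo (0 : ℝ) 1, 0 < pcurve t ∧ pcurve t < 1) :=
  Iff.rfl

theorem exists_mem_univ_close (q ε : ℝ) (hε : 0 < ε) : ∃ k ∈ (Set.univ : Set ℝ), |q - k| ≤ ε :=
  ⟨q, Set.mem_univ _, by rw [sub_self, abs_zero]; exact hε.le⟩

/-- **WITNESS (F3/BC5).** The floor member `K = univ` of the family holds outright, from the seed theorem alone
(the quotient clause is vacuous: take `k :=` the quotient itself). -/
theorem isoTangentWithin_floor : IsoTangentWithin Set.univ :=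
  ⟨criticalCurveRegular_iff_named.1
    Summit.CriticalPhenomena.PercolationContinuityZ3.Cruxes.CriticalCurveRegular.Locmod.CriticalCurveRegular_proof,
    fun ε hε => ⟨1, one_pos, fun _ _ _ => exists_mem_univ_close _ ε hε⟩⟩

/-- The same witness as an `example` (the brief's F3 form). -/
example : IsoTangentWithin Set.univ := isoTangentWithin_floor

/-- Conversely every member of the family contains the floor (monotone family, floor at the top). -/
theorem floor_of_member (K : Set ℝ) (h : IsoTangentWithin K) : CriticalCurveRegular :=
  criticalCurveRegular_iff_named.2 h.1

/-- In particular the rung implies the floor. -/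
theorem floor_of_rung (h : IsotropicTangency) : CriticalCurveRegular := floor_of_member _ h

end Summit.CriticalPhenomena.PercolationContinuityZ3.Cruxes.SupercritExchangeUniformity.IsoTangent.Special
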